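import Summits.BirchSwinnertonDyer.BirchSwinnertonDyer.Theorems.AlignedTransportAtTwoBSDOfMainConjectureRankOneAtTwoSigmaSqTwoVeluDifferential
import Literature.NumberTheory.EllipticCurves.PadicSigmaVariableChangeProofs
import HarnessLib

/-!
# Vélu's `2`-isogeny followed by a change of variables: the isogeny parameter `T = θ_vc(τ)` of ANY model `vc • V'` of
# the quotient satisfies `log_{vc•V'}(T) = u·log_V` and the pole-cleared `x`-relation `u²·x''(T) = x + t/(x − e) − r` —
# EXACTLY the hypotheses `hlog` (`π = u`) and `hx` (`r₀ = −r`) of the squared `2`-isogeny functional equation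
# (`X_sq_mul_sq_subst_eq_of_twoIsogeny`); step S4 of the discharge plan for the PRINT stub `stub_sigmaSqTwo` (route-independent)

Cell `bsd-f1-sign2`, WIDTH-5 attach seat `bsd-line-att-p3` g8 (`--supports stmt-BirchSwinnertonDyer-23008`; plan
`Cruxes/BSDOfMainConjectureRankOneAtTwo/SIGMASQ-AT-TWO-att-p3.md`). THEOREMS ONLY; sequel of `…SigmaSqTwoVeluDifferential.lean`.
BSD is not proved by any of this. With this file the per-curve inputs of the functional equation are COMPLETE for every model of
`E/⟨Q⟩` (in particular the Frobenius-compatible model `[u = 2; r, ½, −r/2]·V'` of plan S3, recon R5): what remains for a discharge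
is the universal chart (S1), the congruences of the Frobenius model (S3: `T ≡ z²`, `V ≡ 1 (mod 2)`), the constant relation (S5') and Dwork (S6).

* `velu_two_formalLog_transport` — `log_{vc•V'}(θ_vc(τ)) = u·log_V` (tree `formalLog_variableChange_subst` ∘ `velu_two_formalLog_subst`);
* `velu_two_x_transport` — `u²·X_{vc•V'}(T)·z²(X − ez²) = T²·(X(X − ez²) + tz⁴ + (−r)z²(X − ez²))`
  (tree `formalXMulSq_variableChange_subst_mul_X_sq` ∘ `velu_two_x_relation`).

## Sources
* J. Vélu, C. R. Acad. Sci. Paris 273 (1971). [cite: SilvermanAEC2009, III.4]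
* J. H. Silverman, *AEC* 2nd ed., III.1 Table 3.1 (`x = u²x' + r`, `u⁻¹ω' = ω`), IV.1. [cite: SilvermanAEC2009, IV.1.1]
* C. Blakestad, D. Grant, J. Number Theory 249 (2023), Prop. 7 (the model `E'_{p/H}` of the quotient). [cite: BlakestadGrant2023, Prop. 7]
-/

noncomputable section

set_option linter.dupNamespace false
set_option autoImplicit false

open scoped Classical
open PowerSeries WeierstrassCurve Literature.NumberTheory.EllipticCurves

namespace Summit.BirchSwinnertonDyer.BirchSwinnertonDyer.Theorems.AlignedTransportAtTwoSigmaSqTwo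

variable {R : Type*} [CommRing R] [IsDomain R] [Algebra ℚ R] (V : WeierstrassCurve R)

/-- **`log_{vc • V'}(θ_vc(τ)) = u·log_V`**: the hypothesis `hlog` of `X_sq_mul_sq_subst_eq_of_twoIsogeny` with `π = u` for ANY model
`vc • V'` of Vélu's quotient `V' = V/⟨(e,f)⟩`, `T = θ_vc ∘ τ`. [cite: SilvermanAEC2009, IV.5.5] [cite: BlakestadGrant2023, Prop. 7] -/
theorem velu_two_formalLog_transport {e f t : R}
    (hQ : f ^ 2 + V.a₁ * e * f + V.a₃ * f = e ^ 3 + V.a₂ * e ^ 2 + V.a₄ * e + V.a₆)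
    (h2 : 2 * f + V.a₁ * e + V.a₃ = 0) (ht : t = 3 * e ^ 2 + 2 * V.a₂ * e + V.a₄ - V.a₁ * f)
    {A M Dn u τ P : R⟦X⟧} (hA : A = V.formalXMulSq - C e * X ^ 2) (hM : M = V.formalXMulSq * A + C t * X ^ 4)
    (hDn : Dn = V.formalXMulSq * A ^ 2 + C t * X ^ 4 * (C V.a₁ * X * A - V.formalXMulSq - C f * X ^ 3))
    (hu : Dn * u = 1) (hτ : τ = X * A * M * u) (hP : P = A * M ^ 3 * u ^ 2)
    (V' : WeierstrassCurve R) (h1' : V'.a₁ = V.a₁) (h2' : V'.a₂ = V.a₂) (h3' : V'.a₃ = V.a₃)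
    (h4' : V'.a₄ = V.a₄ - 5 * t) (h6' : V'.a₆ = V.a₆ - V.b₂ * t - 7 * e * t)
    (vc : VariableChange R) {T : R⟦X⟧} (hT : T = (V'.formalVariableChange vc).subst τ) :
    (vc • V').formalLog.subst T = C (vc.u : R) * V.formalLog := by
  haveI := IsAddTorsionFree.of_module_rat (M := R)
  have hlog := velu_two_formalLog_subst V hQ h2 ht hA hM hDn hu hτ hP V' h1' h2' h3' h4' h6'
  have hτ0 : constantCoeff τ = 0 := by
    rw [hτ, map_mul, map_mul, map_mul, constantCoeff_X]; ring
  have hsτ : HasSubst τ := HasSubst.of_constantCoeff_zero' hτ0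
  have hsθ := V'.hasSubst_formalVariableChange vc
  rw [hT, ← subst_comp_subst_apply hsθ hsτ, V'.formalLog_variableChange_subst vc, subst_mul hsτ,
    Literature.NumberTheory.EllipticCurves.C_subst, hlog]

omit [Algebra ℚ R] in
/-- **`u²·x''(T) = x + t/(x − e) − r`, cleared**: the hypothesis `hx` of `X_sq_mul_sq_subst_eq_of_twoIsogeny` with `π = u`, `r₀ = −r` for
ANY model `vc • V'` of Vélu's quotient, `T = θ_vc ∘ τ`:
`u²·X_{vc•V'}(T)·z²(X − ez²) = T²·(X(X − ez²) + tz⁴ + (−r)·z²(X − ez²))`. [cite: SilvermanAEC2009, III.1 Table 3.1 and IV.1.1]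
[cite: BlakestadGrant2023, Prop. 7] -/
theorem velu_two_x_transport {e f t : R}
    (hQ : f ^ 2 + V.a₁ * e * f + V.a₃ * f = e ^ 3 + V.a₂ * e ^ 2 + V.a₄ * e + V.a₆)
    (h2 : 2 * f + V.a₁ * e + V.a₃ = 0) (ht : t = 3 * e ^ 2 + 2 * V.a₂ * e + V.a₄ - V.a₁ * f)
    {A M Dn u τ : R⟦X⟧} (hA : A = V.formalXMulSq - C e * X ^ 2) (hM : M = V.formalXMulSq * A + C t * X ^ 4)
    (hDn : Dn = V.formalXMulSq * A ^ 2 + C t * X ^ 4 * (C V.a₁ * X * A - V.formalXMulSq - C f * X ^ 3))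
    (hu : Dn * u = 1) (hτ : τ = X * A * M * u)
    (V' : WeierstrassCurve R) (h1' : V'.a₁ = V.a₁) (h2' : V'.a₂ = V.a₂) (h3' : V'.a₃ = V.a₃)
    (h4' : V'.a₄ = V.a₄ - 5 * t) (h6' : V'.a₆ = V.a₆ - V.b₂ * t - 7 * e * t)
    (vc : VariableChange R) {T : R⟦X⟧} (hT : T = (V'.formalVariableChange vc).subst τ) :
    C (vc.u : R) ^ 2 * (vc • V').formalXMulSq.subst T * (X ^ 2 * (V.formalXMulSq - C e * X ^ 2)) =
      T ^ 2 * (V.formalXMulSq * (V.formalXMulSq - C e * X ^ 2) + C t * X ^ 4 +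
        C (-vc.r) * X ^ 2 * (V.formalXMulSq - C e * X ^ 2)) := by
  -- constant terms and non-vanishing of `τ`
  have hA0 : constantCoeff A = 1 := by
    rw [hA, map_sub, map_mul, map_pow, constantCoeff_X, constantCoeff_formalXMulSq]; ring
  have hM0 : constantCoeff M = 1 := by
    rw [hM, map_add, map_mul, map_mul, map_pow, constantCoeff_X, constantCoeff_formalXMulSq, hA0]; ring
  have hDn0 : constantCoeff Dn = 1 := by
    rw [hDn, map_add, map_mul, map_mul, map_mul, map_pow, map_pow, constantCoeff_X, constantCoeff_formalXMulSq, hA0]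
    ring
  have hu0 : constantCoeff u = 1 := by
    have e1 := congrArg constantCoeff hu
    rw [map_mul, hDn0, one_mul, map_one] at e1
    exact e1
  have hτ0 : constantCoeff τ = 0 := by
    rw [hτ, map_mul, map_mul, map_mul, constantCoeff_X]; ring
  have hτne : τ ≠ 0 := by
    intro h
    have e1 : coeff 1 τ = 1 := by
      rw [hτ, mul_assoc, mul_assoc, coeff_succ_X_mul, coeff_zero_eq_constantCoeff, map_mul, map_mul, hA0, hM0, hu0]
      ring
    rw [h, map_zero] at e1
    exact zero_ne_one e1
  have hsτ : HasSubst τ := HasSubst.of_constantCoeff_zero' hτ0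
  have hsθ := V'.hasSubst_formalVariableChange vc
  -- the two ingredients, read through `τ`
  have hx₁ : V'.formalXMulSq.subst τ * (X ^ 2 * (V.formalXMulSq - C e * X ^ 2)) =
      τ ^ 2 * (V.formalXMulSq * (V.formalXMulSq - C e * X ^ 2) + C t * X ^ 4) := by
    have h := velu_two_x_relation V hQ h2 ht hA hM hDn hu V' h1' h2' h3' h4' h6'
    rw [← hτ] at h
    exact h
  have hθτ : (vc • V').formalXMulSq.subst T * τ ^ 2 =
      C ((vc.u⁻¹ : Rˣ) : R) ^ 2 * T ^ 2 * (V'.formalXMulSq.subst τ - C vc.r * τ ^ 2) := by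
    have h := congrArg (PowerSeries.subst τ) (V'.formalXMulSq_variableChange_subst_mul_X_sq vc)
    rw [subst_mul hsτ, subst_comp_subst_apply hsθ hsτ, ← hT, subst_pow hsτ, subst_X hsτ, subst_mul hsτ, subst_mul hsτ,
      subst_pow hsτ, Literature.NumberTheory.EllipticCurves.C_subst, subst_pow hsτ, ← hT, subst_sub hsτ, subst_mul hsτ,
      Literature.NumberTheory.EllipticCurves.C_subst, subst_pow hsτ, subst_X hsτ] at h
    exact h
  have huu : (C (vc.u : R) : R⟦X⟧) * C ((vc.u⁻¹ : Rˣ) : R) = 1 := C_u_mul_C_u_inv vc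
  -- combine and cancel `τ²`
  have key : (C (vc.u : R) ^ 2 * (vc • V').formalXMulSq.subst T * (X ^ 2 * (V.formalXMulSq - C e * X ^ 2))) * τ ^ 2 =
      (T ^ 2 * (V.formalXMulSq * (V.formalXMulSq - C e * X ^ 2) + C t * X ^ 4 +
        C (-vc.r) * X ^ 2 * (V.formalXMulSq - C e * X ^ 2))) * τ ^ 2 := by
    rw [map_neg]
    linear_combination (C (vc.u : R) ^ 2 * (X ^ 2 * (V.formalXMulSq - C e * X ^ 2))) * hθτ + T ^ 2 * hx₁ +
      ((C (vc.u : R) * C ((vc.u⁻¹ : Rˣ) : R) + 1) * T ^ 2 *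
        (V'.formalXMulSq.subst τ * (X ^ 2 * (V.formalXMulSq - C e * X ^ 2)) -
          C vc.r * τ ^ 2 * (X ^ 2 * (V.formalXMulSq - C e * X ^ 2)))) * huu
  exact mul_right_cancel₀ (pow_ne_zero 2 hτne) key

end Summit.BirchSwinnertonDyer.BirchSwinnertonDyer.Theorems.AlignedTransportAtTwoSigmaSqTwo
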